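import Mathlib.Algebra.BigOperators.Fin
import Mathlib.Data.ZMod.Basic

/-!
# Crux `CubicForrelation.NearExactIsExact` (stmt-QuantumAdvantage-14043) — from "`G|_{H×H} = ε·ω`" to the leaf format
  `G = ε·ι_{s₀}t̄ + s₀ ∧ g`

Certificate seat `b2b-cforr-cert` (gen 41).  HONEST FRAMING: a kernel-checked triviality (standard axioms, Mathlib only) closing the gap
between the Boolean light structure (…CubicFormLightStructure `tls_light_structure`: the `H × H` block of the slice `G` is `ε·ω`) and the
hypothesis `hG`/`hΓ` of the ω-leaves (…TwelvePartnerR2LeafW8 `tpa_R2_w8`: `G(s,t) = ε·d(z0,s,t) + [s = z0]·g(t) + [t = z0]·g(s)` for ALL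
`s, t`, the `z0`-row `g` being free): a symmetric `G` with `G(z0,z0) = 0` whose off-`z0` block is `ε·W` (where `W`'s `z0`-row and column
vanish) has this form with `g = G(z0, ·)`.  Step (3)/(4) glue of HOME/b2b-cforr-cert-g41/ASSEMBLY-BLUEPRINT-W8.md.  Nothing about `θ₁₂`;
NOT summit progress.

* `tlg_light_rows`: the statement above, for tensors `Fin m → Fin m → ZMod 2` and any distinguished index `z0`.

References: folklore.  Axioms: the standard three.
-/

set_option linter.dupNamespace false -- D-0017: single-problem summit ⇒ `QuantumAdvantage.QuantumAdvantage` by design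

namespace Summit.QuantumAdvantage.QuantumAdvantage.Theorems.CubicForrelation.NearExactIsExact

/-- **Leaf format of the light structure.**  See the module docstring. [folklore] -/
theorem tlg_light_rows {m : ℕ} (G W : Fin m → Fin m → ZMod 2) (z0 : Fin m) (ε : ZMod 2)
    (hGs : ∀ s t, G t s = G s t) (hG0 : G z0 z0 = 0)
    (hWr : ∀ t, W z0 t = 0) (hWc : ∀ s, W s z0 = 0)
    (hblock : ∀ s t, s ≠ z0 → t ≠ z0 → G s t = ε * W s t) :
    ∀ s t, G s t = ε * W s t + (if s = z0 then G z0 t else 0) + (if t = z0 then G z0 s else 0) := by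
  intro s t
  by_cases hs : s = z0
  · subst hs
    by_cases ht : t = s
    · subst ht; simp only [if_true, hG0, hWr, mul_zero, zero_add]
    · rw [hWr, if_pos rfl, if_neg ht, mul_zero, zero_add, add_zero]
  · by_cases ht : t = z0
    · subst ht; rw [hWc, if_neg hs, if_pos rfl, mul_zero, zero_add, zero_add, hGs]
    · rw [hblock s t hs ht, if_neg hs, if_neg ht, add_zero, add_zero]

/-- **Boolean multiples read in `𝔽₂`**: `[ε ∧ b] = [ε]·[b]`. [folklore] -/
theorem tlg_ite_and (ε b : Bool) :
    (if (ε && b) = true then (1 : ZMod 2) else 0) = (if ε = true then (1 : ZMod 2) else 0) * (if b = true then (1 : ZMod 2) else 0) := by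
  cases ε <;> cases b <;> decide

end Summit.QuantumAdvantage.QuantumAdvantage.Theorems.CubicForrelation.NearExactIsExact
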